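import Summits.QuantumFields.YangMills.Theorems.UnitScaleTiltProp8ChartIterSmall
import Summits.QuantumFields.YangMills.Theorems.UnitScaleTiltProp8ChartBridge
import Summits.QuantumFields.YangMills.Theorems.UnitScaleTiltProp7AxialGaugeSup
import Summits.QuantumFields.YangMills.Theorems.UnitScaleTiltProp7AxialGauge
import Summits.QuantumFields.YangMills.Theorems.UnitScaleTiltProp8FlatCubeSequence
import Summits.QuantumFields.YangMills.Theorems.UnitScaleTiltProp8LocaliseText
import Literature.MathematicalPhysics.QuantumFieldTheory.Balaban1983to89.B12RegularClassInvariance263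
import Literature.MathematicalPhysics.QuantumFieldTheory.BalabanImbrieJaffe1984to88.BIJ88RT51Background
import HarnessLib

/-!
# Route `UnitScaleTilt`, crux K1 «MinimiserStabilityRegPr» (stmt-QuantumFields-19200), leaf V2′ — pillar P0 `Localise150`, THE OPEN HALF: **k-UNIFORM MULTI-LEVEL
# PLAQUETTE SMALLNESS OF THE (0.4)-DESCENT FOR EVERY BLOCK SIZE `L`** (no `L ≥ 7` threshold), part 1: geometry of the four-block cluster of a coarse plaquette and
# the axial gauge bond bound on it

Cell `ym3-torus`, seat `ym3-torus-p1` g18 (UV3-NODE §27.7).  The tree's `IterPlaqSmall.plaqSmall_iter_T3` (p532781) needs `L ≥ 7` (transport-defect recursion).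
The all-`L` route: ★ym-ust-19200-p2 g6's `Prop8Chart.norm_emlIterU_sub_one_le_of_reads` (p550894) bounds the UNGUARDED iterated average `Ū^{(i)}(e)` by
`30ℓ·Lⁱ·s₀` from the fine BOND deviations `s₀` under the `i`-blocks of the two ends of `e` — k-uniformly, every `L`, budget `6400ℓ²Lⁱs₀ ≤ 1`; and in the AXIAL
GAUGE based at the centre of the cluster of the four `i`-blocks around a plaquette `p′` of `T^{(i)}` the bond deviations are `≤ 2·l₁·a₀ ≤ 6d·Lⁱ·a₀` when the fine
plaquettes are within `a₀` of `1` (`AxialGaugeSup.dist1_mul_inv_le_of_axial`).  This file: §1 the cluster sits within fine sup-distance `3Lⁱ − 1` of the centre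
`embIter i p′₋` (no wrap-around for `i + 1 ≤ m + K`), §2 the gauge `W = U^{u}`, `u = axialT U y`, is axial from `y` and its bonds under the cluster are
`2·d(3Lⁱ−1)·a₀`-close to `1`.  Theorems only.  NOT a claim about the mass gap.

References: T. Bałaban, CMP **102** (1985) 277–309 [Balaban1985Variational] ((145)–(146) p.301); CMP **99** (1985) 75–102 [Balaban1985RegularSpaces]
(Lemma 1 p.79); CMP **98** (1985) 17–51 [Balaban1985Averaging] (pp.24–25, Prop. 4 p.38).
-/

noncomputable section

open scoped BigOperators

namespace Summit.QuantumFields.YangMills.Theorems.IterPlaqSmallAllL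

open Literature.MathematicalPhysics.QuantumFieldTheory.Balaban1983to89
open T4Continuum BlockAveraging
open B5Eq118OneStroke (iterBlockOf iterBlockOf_succ iterBlockOf_zero)
open B15DeterminingSets (embIter)
open B5Prop12FieldsLattice (distSite)
open B5Eq117TorusCarriers (Mk)
open B5RowSumsP12Lattice (distSite_comm distSite_triangle)
open B7Prop1Explicit (l1)
open B10Eq27TorusAxialLog (rel rel_apply axialT axialT_self gaugeActT gaugeActT_apply holT_one)
open Literature.MathematicalPhysics.QuantumFieldTheory.BalabanImbrieJaffe1984to88.BIJ88RT51Background (iterBlockOf_embIter)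
open Summit.QuantumFields.YangMills.Theorems.Prop7AxialGauge (axialT_gaugeActT)
open Summit.QuantumFields.YangMills.Theorems.Prop7AxialGaugeSup (dist1_mul_inv_le_of_axial)

variable {P : Params}

/-! ## §1 The four-block cluster of a coarse plaquette, seen from the centre of its first block -/

/-- **`dist₀(x, x′) ≤ Lⁱ·dist_i(Bⁱx, Bⁱx′) + (Lⁱ − 1)`** (the cross-level inequality `FlatCubeSequence.distSite_le_blockOf` iterated; `i ≤ m + K`). [folklore] -/
theorem distSite_zero_le_pow : ∀ (i : ℕ), i ≤ P.m + P.K → ∀ (x x' : Site P 0),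
    distSite (Mk P 0) x x' ≤ (P.L : ℝ) ^ i * distSite (Mk P i) (iterBlockOf i x) (iterBlockOf i x') + ((P.L : ℝ) ^ i - 1)
  | 0, _, x, x' => by simp
  | i + 1, hi, x, x' => by
    have ih := distSite_zero_le_pow i (by omega) x x'
    have h1 := FlatCubeSequence.distSite_le_blockOf hi (iterBlockOf i x) (iterBlockOf i x')
    have hL0 : (0 : ℝ) ≤ (P.L : ℝ) ^ i := by positivity
    rw [iterBlockOf_succ, iterBlockOf_succ, pow_succ]
    nlinarith [mul_le_mul_of_nonneg_left h1 hL0]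

/-- each relative coordinate is bounded by the sup circular distance. [folklore] -/
theorem natAbs_rel_le_distSite {j : ℕ} (y x : Site P j) (ν : Fin P.d) : ((rel y x ν).natAbs : ℝ) ≤ distSite (Mk P j) x y := by
  unfold distSite
  rw [rel_apply]
  exact_mod_cast Finset.le_sup (f := fun μ : Fin P.d => ((x μ - y μ).valMinAbs).natAbs) (Finset.mem_univ ν)

/-- `l₁` of the relative position is at most `d` times the sup circular distance. [folklore] -/
theorem l1_rel_le_distSite {j : ℕ} (y x : Site P j) : (l1 (rel y x) : ℝ) ≤ (P.d : ℝ) * distSite (Mk P j) x y := by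
  unfold l1
  push_cast
  calc ∑ κ : Fin P.d, ((rel y x κ).natAbs : ℝ) ≤ ∑ _κ : Fin P.d, distSite (Mk P j) x y := Finset.sum_le_sum fun κ _ => natAbs_rel_le_distSite y x κ
    _ = (P.d : ℝ) * distSite (Mk P j) x y := by rw [Finset.sum_const, Finset.card_univ, Fintype.card_fin, nsmul_eq_mul]

/-- the four corners of a plaquette `(z; μ, ν)` of `T^{(i)}` are within sup-distance `2` of `z`. [folklore] -/
theorem distSite_corner_le_two {i : ℕ} (z : Site P i) (μ ν : Fin P.d) {z' : Site P i}
    (hz' : z' = z ∨ z' = z.shift μ ∨ z' = z.shift ν ∨ z' = (z.shift μ).shift ν) : distSite (Mk P i) z' z ≤ 2 := by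
  have h1 : ∀ (w : Site P i) (κ : Fin P.d), distSite (Mk P i) (w.shift κ) w ≤ 1 := fun w κ => by
    rw [distSite_comm]; exact FlatCubeQContraction.distSite_shift_le_one w κ
  rcases hz' with rfl | rfl | rfl | rfl
  · rw [B5Prop12FieldsLattice.distSite_self]; norm_num
  · exact (h1 z μ).trans (by norm_num)
  · exact (h1 z ν).trans (by norm_num)
  · calc distSite (Mk P i) ((z.shift μ).shift ν) z ≤ distSite (Mk P i) ((z.shift μ).shift ν) (z.shift μ) + distSite (Mk P i) (z.shift μ) z :=
          distSite_triangle _ _ (z.shift μ) _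
      _ ≤ 1 + 1 := add_le_add (h1 _ ν) (h1 z μ)
      _ = 2 := by norm_num

/-- **THE CLUSTER FROM THE CENTRE**: a fine site `x` whose `i`-block is a corner of the plaquette `(z; μ, ν)` is within fine sup-distance `3Lⁱ − 1` of the centre
`embIter i z` (`i ≤ m + K`). [cite: Balaban1985RegularSpaces, Lemma 1 p.79 (bookkeeping)] -/
theorem distSite_cluster_le {i : ℕ} (hi : i ≤ P.m + P.K) (z : Site P i) (μ ν : Fin P.d) (x : Site P 0)
    (hx : iterBlockOf i x = z ∨ iterBlockOf i x = z.shift μ ∨ iterBlockOf i x = z.shift ν ∨ iterBlockOf i x = (z.shift μ).shift ν) :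
    distSite (Mk P 0) x (embIter i z) ≤ 3 * (P.L : ℝ) ^ i - 1 := by
  have h := distSite_zero_le_pow i hi x (embIter i z)
  rw [iterBlockOf_embIter i hi] at h
  have h2 := distSite_corner_le_two z μ ν hx
  have hL0 : (0 : ℝ) ≤ (P.L : ℝ) ^ i := by positivity
  nlinarith [mul_le_mul_of_nonneg_left h2 hL0]

/-- hence `l₁(x − embIter i z) ≤ d·(3Lⁱ − 1)` and each coordinate is `≤ 3Lⁱ − 1` in absolute value. [cite: Balaban1985RegularSpaces, Lemma 1 p.79 (bookkeeping)] -/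
theorem l1_rel_cluster_le {i : ℕ} (hi : i ≤ P.m + P.K) (z : Site P i) (μ ν : Fin P.d) (x : Site P 0)
    (hx : iterBlockOf i x = z ∨ iterBlockOf i x = z.shift μ ∨ iterBlockOf i x = z.shift ν ∨ iterBlockOf i x = (z.shift μ).shift ν) :
    (l1 (rel (embIter i z) x) : ℝ) ≤ (P.d : ℝ) * (3 * (P.L : ℝ) ^ i - 1) :=
  (l1_rel_le_distSite _ _).trans (mul_le_mul_of_nonneg_left (distSite_cluster_le hi z μ ν x hx) (Nat.cast_nonneg _))

/-- **NO WRAP-AROUND ON THE CLUSTER** (`i + 1 ≤ m + K`; `L ≥ 3` as `L` is odd `> 1`): `2((x − y)_κ + 1) ≤ N₀` for the centre `y = embIter i z`.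
[cite: Balaban1985RegularSpaces, Lemma 1 p.79 (bookkeeping)] -/
theorem noWrap_cluster {i : ℕ} (hi : i + 1 ≤ P.m + P.K) (z : Site P i) (μ ν : Fin P.d) (x : Site P 0)
    (hx : iterBlockOf i x = z ∨ iterBlockOf i x = z.shift μ ∨ iterBlockOf i x = z.shift ν ∨ iterBlockOf i x = (z.shift μ).shift ν) (κ : Fin P.d) :
    (rel (embIter i z) x κ + 1) * 2 ≤ (P.sitesPerDir 0 : ℤ) := by
  have hL3 : 3 ≤ P.L := by obtain ⟨a, ha⟩ := P.hL.1; have := P.hL.2; omega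
  have hdist := (natAbs_rel_le_distSite (embIter i z) x κ).trans (distSite_cluster_le (Nat.le_of_succ_le hi) z μ ν x hx)
  -- `|rel| ≤ 3Lⁱ − 1` as naturals
  have hnat : (rel (embIter i z) x κ).natAbs + 1 ≤ 3 * P.L ^ i := by
    have : ((rel (embIter i z) x κ).natAbs : ℝ) + 1 ≤ 3 * (P.L : ℝ) ^ i := by linarith
    exact_mod_cast this
  -- `3Lⁱ ≤ L^{i+1} ≤ L^{m+K}` and `N₀ = 2L^{m+K}`
  have hpow : 3 * P.L ^ i ≤ P.L ^ (P.m + P.K) :=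
    (Nat.mul_le_mul_right _ hL3).trans (by rw [← pow_succ']; exact Nat.pow_le_pow_right P.L_pos hi)
  have hN : P.sitesPerDir 0 = 2 * P.L ^ (P.m + P.K) := by simp [Params.sitesPerDir]
  have hnat' : ((rel (embIter i z) x κ).natAbs : ℤ) + 1 ≤ 3 * (P.L : ℤ) ^ i := by exact_mod_cast hnat
  have h3 : 3 * (P.L : ℤ) ^ i ≤ (P.L : ℤ) ^ (P.m + P.K) := by exact_mod_cast hpow
  have hle : rel (embIter i z) x κ ≤ (rel (embIter i z) x κ).natAbs := Int.le_natAbs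
  rw [hN]
  push_cast
  omega

/-! ## §2 The axial gauge from the centre of the cluster -/

section Gauge

variable {G : Type*} [GaugeGroup G]

/-- `gaugeActT` is the tree's gauge action. [cite: Balaban1985Averaging, (8) p.19] -/
theorem gaugeActT_eq_gaugeAct {j : ℕ} (u : GaugeTransf P j G) (V : GaugeField P j G) : gaugeActT u V = GaugeField.gaugeAct u V := rfl

/-- **THE AXIAL GAUGE FROM `y` IS REACHED BY `u = axialT U y`**: `W := U^u` has trivial comb holonomies from `y`: `axialT W y x = 1`.
[cite: Balaban1985Averaging, pp.24-25; Balaban1985RegularSpaces, (1.19) p.79] -/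
theorem axialT_gaugeActT_axialT {j : ℕ} (U : GaugeField P j G) (y x : Site P j) : axialT (gaugeActT (axialT U y) U) y x = 1 := by
  rw [axialT_gaugeActT, axialT_self, one_mul, mul_inv_cancel]

/-- plaquette smallness is preserved by the gauge action. [cite: Balaban1987RG1, (0.18) p.255] -/
theorem plaqSmall_gaugeActT {j : ℕ} {δ : ℝ} (u : GaugeTransf P j G) {U : GaugeField P j G} (hU : PlaqSmall δ U) : PlaqSmall δ (gaugeActT u U) := by
  rw [gaugeActT_eq_gaugeAct]
  exact (B12RegularClassInvariance263.plaqSmall_gaugeAct_iff δ u U).2 hU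

/-- **THE BOND BOUND ON THE CLUSTER IN THE AXIAL GAUGE** ([Balaban1985RegularSpaces] Lemma 1, flat background): if every plaquette variable of `U` is within
`a₀ > 0` of `1`, then for `W = U^{axialT U y}`, `y = embIter i z`, every fine bond `b` whose end-points' `i`-blocks are corners of the plaquette `(z; μ, ν)` has
`dist1(W_b) ≤ 2d(3Lⁱ − 1)·a₀` (`i + 1 ≤ m + K`). [cite: Balaban1985RegularSpaces, Lemma 1 (1.25) p.79; Balaban1985Averaging, pp.24-25] -/
theorem dist1_axial_cluster_le {i : ℕ} (hi : i + 1 ≤ P.m + P.K) (U : GaugeField P 0 G) {a₀ : ℝ} (ha₀ : 0 < a₀) (hU : PlaqSmall a₀ U)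
    (z : Site P i) (μ ν : Fin P.d) (b : PBond P 0)
    (hb : iterBlockOf i b.src = z ∨ iterBlockOf i b.src = z.shift μ ∨ iterBlockOf i b.src = z.shift ν ∨ iterBlockOf i b.src = (z.shift μ).shift ν)
    (hb' : iterBlockOf i b.tgt = z ∨ iterBlockOf i b.tgt = z.shift μ ∨ iterBlockOf i b.tgt = z.shift ν ∨ iterBlockOf i b.tgt = (z.shift μ).shift ν) :
    dist1 (gaugeActT (axialT U (embIter i z)) U b) ≤ 2 * ((P.d : ℝ) * (3 * (P.L : ℝ) ^ i - 1)) * a₀ := by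
  set y := embIter i z with hy
  set W := gaugeActT (axialT U y) U with hW
  have hWs : PlaqSmall a₀ W := plaqSmall_gaugeActT _ hU
  have h1s : PlaqSmall a₀ (fun _ : PBond P 0 => (1 : G)) := fun p => by
    simp only [GaugeField.plaqHol, mul_one, inv_one, GaugeGroup.dist1_one]; exact ha₀
  obtain ⟨x, κ⟩ := b
  have hax : axialT W y x = axialT (fun _ : PBond P 0 => (1 : G)) y x := by
    rw [hW, axialT_gaugeActT_axialT]; unfold axialT; rw [holT_one]
  have hax' : axialT W y (x.shift κ) = axialT (fun _ : PBond P 0 => (1 : G)) y (x.shift κ) := by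
    rw [hW, axialT_gaugeActT_axialT]; unfold axialT; rw [holT_one]
  have hwrap := noWrap_cluster hi z μ ν x hb κ
  have h := dist1_mul_inv_le_of_axial W (fun _ : PBond P 0 => (1 : G)) ha₀.le ha₀.le hWs h1s y x κ hwrap hax hax'
  simp only [inv_one, mul_one] at h
  refine h.trans ?_
  have hl1 := l1_rel_cluster_le (Nat.le_of_succ_le hi) z μ ν x hb
  have : (l1 (rel y x) : ℝ) * (a₀ + a₀) ≤ (P.d : ℝ) * (3 * (P.L : ℝ) ^ i - 1) * (a₀ + a₀) :=
    mul_le_mul_of_nonneg_right hl1 (by positivity)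
  linarith

end Gauge


end Summit.QuantumFields.YangMills.Theorems.IterPlaqSmallAllL

end
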